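import Summits.AtomisticToContinuum.Crystallization.Theorems.FrustratedLawDichotomyTwoShellRigidityLsLedgerSphere

/-!
# FrustratedLawDichotomy · TwoShellRigidity · the ls re-gauging LEDGER, part D (§6, section Arrow) (lens-3 g34 node d77bada9, split for the ≤ 400-line rule; critic row 662 (B)(2))

§6 — the re-gauging ledger as a kernel arrow: `SphericalLsFit`, `gEntryAt_lsGauge_of_sphericalLsFit`, the fcc/hcp instances and the worked examples.  Same namespace as parts A–D (`…FrustratedLawDichotomyTwoShellRigidityLsLedger`); bodies byte-identical to the node; the node's full
module documentation is in part A (`…LsLedgerFrame`).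
-/

noncomputable section

namespace Summit.AtomisticToContinuum.Crystallization.Theorems.FrustratedLawDichotomyTwoShellRigidityLsLedger

open Literature.Geometry.DiscreteGeometry
open Summit.AtomisticToContinuum.Crystallization.Theorems.FrustratedLawDichotomyTwoShellRigidityCut
open Summit.AtomisticToContinuum.Crystallization.Theorems.FrustratedLawDichotomyTwoShellRigidityCells
open Summit.AtomisticToContinuum.Crystallization.Theorems.FrustratedLawDichotomyTwoShellRigidityGaugedLadder
open Summit.AtomisticToContinuum.Crystallization.Theorems.FrustratedLawDichotomyTwoShellRigidityLsEntry
open scoped RealInnerProductSpace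

/-! ## §6 THE RE-GAUGING LEDGER AS A KERNEL ARROW: `GEntryAt Pat D (lsGauge Pat) θ P ⟸ CapBrace ∧ SphericalLsFit ∧ arithmetic` -/

section Arrow

open Summit.AtomisticToContinuum.Crystallization.Theorems.FrustratedLawDichotomyBondGraphWindows
  (nearestDist_pos_of_adj dist_le_mul_dist_of_adj dist_le_mul_dist_of_adj' min_dist_lt_dist_of_not_adj)
open Summit.AtomisticToContinuum.Crystallization.Theorems.FrustratedLawDichotomyLinkIsoToolkit
  (ne_centre_of_linkIso injective_of_linkIso)
open Summit.AtomisticToContinuum.Crystallization.Theorems.FrustratedLawDichotomySphericalLinkCert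
  (inner_unit_le_of_dist_ge le_inner_unit_of_dist_le inner_unit_lt_of_min_lt_dist)
open Summit.AtomisticToContinuum.Crystallization.Theorems.FrustratedLawDichotomyTwoShellRigidityLadder (CapAprioriAt)
open Summit.AtomisticToContinuum.Crystallization.Theorems.FrustratedLawDichotomyTwoShellRigidityLadderCap
  (capAprioriAt_trilateration_fcc capAprioriAt_trilateration_hcp)
open Summit.AtomisticToContinuum.Crystallization.Theorems.FrustratedLawDichotomyTwoShellRigidityGaugeFix
  (gaugeFix_fcc gaugeFix_hcp frame_fcc frame_hcp two_sqrt_three_le)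
open Summit.AtomisticToContinuum.Crystallization.Theorems.FrustratedLawDichotomyCappedRigidityCertPatterns
  (fcc_contactSeparating hcp_contactSeparating)

/-- **`SphericalLsFit β θ Pat D α Ω V₁ V₃` — the FINITE, CONFIGURATION-FREE entry target on `(S²)¹²`** [INSTRUMENTABLE: braced
branch-and-bound of the accepted 12-direction `Rig` engine with per-leaf LINEAR-TARGET certificates; certificate class = interval
arithmetic + LP].  For every dozen of UNIT vectors `e : Pat → S²` inside the three cosine windows of `LinkIso θ` (all pairs
`⟪e u, e v⟫ ≤ 1 − (1+θ)⁻²/2`; pattern contacts `≥ 1 − (1+θ)²/2`; pattern non-contacts `< (1+θ)/2`) AND the square-diagonal brace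
`|⟪e u, e v⟫| ≤ β` (`dist u v = √2`), there is an isometry `A` (the engine's leaf frame) whose frame residuals `a_u = A⁻¹ e_u − u` satisfy:
(F0) `‖a_u‖ ≤ α`; (F1) `‖lsRot a‖ ≤ Ω` (`lsRot a = (1/8) Σ_u u × a_u`, the least-squares rotation the leaf frame misses); (F2) for every probe
`n ∈ D`, `⟪n, a_u − (lsRot a) × u⟫ ≤ V₁`; (F3) for every probe and pattern contact, `⟪n, (a_u − (lsRot a) × u) − (a_w − (lsRot a) × w)⟫ ≤ V₃`.
All four are LINEAR in `(a_u)_u` for fixed `A` — LinTarget rows in the format of g33/MEMO.md §2. [piece · instrument] -/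
def SphericalLsFit (β θ : ℝ) (Pat : Finset E3) (D : List E3) (α Ω V₁ V₃ : ℝ) : Prop :=
  ∀ e : ↥Pat → E3, (∀ u, ‖e u‖ = 1) →
    (∀ u v : ↥Pat, u ≠ v → ⟪e u, e v⟫ ≤ 1 - (1 + θ)⁻¹ ^ 2 / 2) →
    (∀ u v : ↥Pat, dist (u : E3) (v : E3) = 1 → 1 - (1 + θ) ^ 2 / 2 ≤ ⟪e u, e v⟫) →
    (∀ u v : ↥Pat, u ≠ v → dist (u : E3) (v : E3) ≠ 1 → ⟪e u, e v⟫ < (1 + θ) / 2) →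
    (∀ u v : ↥Pat, dist (u : E3) (v : E3) = Real.sqrt 2 → |⟪e u, e v⟫| ≤ β) →
      ∃ A : E3 ≃ₗᵢ[ℝ] E3,
        (∀ u, ‖frameRes A e u‖ ≤ α) ∧ ‖lsRot Pat (frameRes A e)‖ ≤ Ω ∧
        (∀ n ∈ D, ∀ u : ↥Pat, ⟪n, derot Pat (frameRes A e) u⟫ ≤ V₁) ∧
        (∀ n ∈ D, ∀ u w : ↥Pat, dist (u : E3) (w : E3) = 1 →
          ⟪n, derot Pat (frameRes A e) u - derot Pat (frameRes A e) w⟫ ≤ V₃)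

/-- The shell slop of the ledger: projection `θ(1+α) + (3/2)θα` plus re-gauging `(3/2)·T·a + T²/2 + T·a` (`a = aTot θ α`, `T` the final
operator bound for `B⁻¹A₀ − 1`). -/
def slop₁ (θ α T : ℝ) : ℝ :=
  θ * (1 + α) + 3 / 2 * (θ * α) + (3 / 2 * (T * aTot θ α) + T ^ 2 / 2 + T * aTot θ α)

/-- The contact slop of the ledger: `2θ(1+α) + (3/2)θα + (3/2)·T·a + T²/2 + 2·T·a`. -/
def slop₃ (θ α T : ℝ) : ℝ :=
  2 * (θ * (1 + α)) + 3 / 2 * (θ * α) + (3 / 2 * (T * aTot θ α) + T ^ 2 / 2 + 2 * (T * aTot θ α))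

/-- ★★ **THE RE-GAUGING LEDGER, KERNEL-CHECKED** (configuration level, any pattern that is a unit tight twelve-frame with a separating contact
graph, any probe list of norms `≤ 1` with covering constant `ρ`):

`CapBrace β θ Pat ∧ SphericalLsFit β θ Pat D α Ω V₁ V₃ ∧ GaugeFix Pat (lsGauge Pat) κ ∧ CapAprioriAt Kq K θ Pat` + the arithmetic side
conditions `ledgerStep^[k](κ₁·a) ≤ T` (bootstrap run `k` times from the `GaugeFix` operator bound) and `ρ·(V₁ + slop₁) ≤ K·θ`
⟹ `GEntryAt Pat D (lsGauge Pat) θ (V₁ + slop₁, Kq·θ, V₃ + slop₃, (Kq + K)·θ)`.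

Proof = §4–§5: project the link to the sphere (windows from `LinkIso`, brace from `CapBrace`), take the leaf frame `A₀` of `SphericalLsFit`,
re-gauge it with `GaugeFix` to `B` (gauge equation `Σ u × (B⁻¹p_u − u) = 0`), identify the rotation `B⁻¹A₀` to first order with `−lsRot`
through the isotropy `Σ u × (ω × u) = 8ω`, `Σ u × (sym·u) = 0` of the frame, bootstrap the operator bound, and read the four clause families;
caps from `CapAprioriAt` through the covering constant. [folklore; new as a typed arrow] -/
theorem gEntryAt_lsGauge_of_sphericalLsFit {Pat : Finset E3} {D : List E3} {β θ α Ω V₁ V₃ κ κ₁ ρ K Kq T : ℝ} {k : ℕ}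
    (hθ0 : 0 < θ) (hθ1 : θ ≤ 1 / 2)
    (hPat : ∀ u v : ↥Pat, u ≠ v → ∃ w : ↥Pat, dist (u : E3) (w : E3) = 1 ∧ dist (v : E3) (w : E3) ≠ 1)
    (hcard : Pat.card = 12) (h1 : ∀ z ∈ Pat, ‖z‖ = 1)
    (hframe : ∀ z : E3, ∑ u : ↥Pat, ⟪(u : E3), z⟫ • (u : E3) = (4 : ℝ) • z)
    (hD : ∀ n ∈ D, ‖n‖ ≤ 1) (hρ : 0 ≤ ρ) (hcov : Covers D ρ)
    (hfix : GaugeFix Pat (lsGauge Pat) κ) (hκ : κ ≤ κ₁) (hκ1 : 0 ≤ κ₁)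
    (hQ : CapAprioriAt Kq K θ Pat) (hB : CapBrace β θ Pat) (hS : SphericalLsFit β θ Pat D α Ω V₁ V₃) (hα : 0 ≤ α)
    (hT : (ledgerStep (Ω + 3 / 2 * (θ * α)) (aTot θ α))^[k] (κ₁ * aTot θ α) ≤ T)
    (hK : ρ * (V₁ + slop₁ θ α T) ≤ K * θ) :
    GEntryAt Pat D (lsGauge Pat) θ (V₁ + slop₁ θ α T, Kq * θ, V₃ + slop₃ θ α T, (Kq + K) * θ) := by
  intro N y i τ hy hsep hL hC
  have hθ' : 0 ≤ 1 + θ := by linarith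
  have hτi : ∀ u : ↥Pat, τ u ≠ i := ne_centre_of_linkIso hL
  have hτ : Function.Injective τ := injective_of_linkIso hPat hL
  rcases Pat.eq_empty_or_nonempty with hE | ⟨z₀, hz₀⟩
  · rw [hE] at hcard; simp at hcard
  have hr : 0 < nearestDist y i := nearestDist_pos_of_adj hy (hL.1 ⟨z₀, hz₀⟩)
  have hri : 0 < (nearestDist y i)⁻¹ := inv_pos.2 hr
  -- the rescaled link `p` and its windows
  obtain ⟨p, hp⟩ : ∃ p : ↥Pat → E3, ∀ u, p u = (nearestDist y i)⁻¹ • (y (τ u) - y i) := ⟨_, fun u => rfl⟩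
  have hp_norm : ∀ u, ‖p u‖ = (nearestDist y i)⁻¹ * dist (y i) (y (τ u)) := by
    intro u; rw [hp, norm_smul, Real.norm_of_nonneg hri.le, dist_comm, dist_eq_norm]
  have hp_sub : ∀ u v, ‖p u - p v‖ = (nearestDist y i)⁻¹ * dist (y (τ u)) (y (τ v)) := by
    intro u v; rw [hp, hp, ← smul_sub, sub_sub_sub_cancel_right, norm_smul, Real.norm_of_nonneg hri.le, dist_eq_norm]
  have hrad : ∀ u, 1 ≤ ‖p u‖ ∧ ‖p u‖ ≤ 1 + θ := by
    intro u
    rw [hp_norm]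
    constructor
    · have h := nearestDist_le_dist y (hτi u)
      calc (1 : ℝ) = (nearestDist y i)⁻¹ * nearestDist y i := by field_simp
        _ ≤ (nearestDist y i)⁻¹ * dist (y i) (y (τ u)) := mul_le_mul_of_nonneg_left h hri.le
    · have h := dist_le_of_adj hθ' (hL.1 u)
      calc (nearestDist y i)⁻¹ * dist (y i) (y (τ u)) ≤ (nearestDist y i)⁻¹ * ((1 + θ) * nearestDist y i) :=
            mul_le_mul_of_nonneg_left h hri.le
        _ = 1 + θ := by field_simp
  have hall : ∀ u v : ↥Pat, u ≠ v → ‖p u‖ ≤ (1 + θ) * ‖p u - p v‖ ∧ ‖p v‖ ≤ (1 + θ) * ‖p u - p v‖ := by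
    intro u v huv
    have hne : τ v ≠ τ u := fun e => huv (hτ e).symm
    rw [hp_norm, hp_norm, hp_sub]
    constructor
    · have h := dist_le_mul_dist_of_adj' hθ' (hL.1 u) hne
      calc (nearestDist y i)⁻¹ * dist (y i) (y (τ u)) ≤ (nearestDist y i)⁻¹ * ((1 + θ) * dist (y (τ u)) (y (τ v))) :=
            mul_le_mul_of_nonneg_left h hri.le
        _ = (1 + θ) * ((nearestDist y i)⁻¹ * dist (y (τ u)) (y (τ v))) := by ring
    · have h := dist_le_mul_dist_of_adj' hθ' (hL.1 v) hne.symm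
      rw [dist_comm (y (τ v)) (y (τ u))] at h
      calc (nearestDist y i)⁻¹ * dist (y i) (y (τ v)) ≤ (nearestDist y i)⁻¹ * ((1 + θ) * dist (y (τ u)) (y (τ v))) :=
            mul_le_mul_of_nonneg_left h hri.le
        _ = (1 + θ) * ((nearestDist y i)⁻¹ * dist (y (τ u)) (y (τ v))) := by ring
  have hcon : ∀ u w : ↥Pat, dist (u : E3) (w : E3) = 1 →
      ‖p u - p w‖ ≤ (1 + θ) * ‖p u‖ ∧ ‖p u - p w‖ ≤ (1 + θ) * ‖p w‖ := by
    intro u w huw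
    have hadj : (bondGraph θ y).Adj (τ u) (τ w) := (hL.2.2 u w).2 huw
    rw [hp_norm, hp_norm, hp_sub]
    constructor
    · have h := dist_le_mul_dist_of_adj hθ' hadj (hτi u).symm
      rw [dist_comm (y (τ u)) (y i)] at h
      calc (nearestDist y i)⁻¹ * dist (y (τ u)) (y (τ w)) ≤ (nearestDist y i)⁻¹ * ((1 + θ) * dist (y i) (y (τ u))) :=
            mul_le_mul_of_nonneg_left h hri.le
        _ = (1 + θ) * ((nearestDist y i)⁻¹ * dist (y i) (y (τ u))) := by ring
    · have h := dist_le_mul_dist_of_adj' hθ' hadj (hτi w).symm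
      rw [dist_comm (y (τ w)) (y i)] at h
      calc (nearestDist y i)⁻¹ * dist (y (τ u)) (y (τ w)) ≤ (nearestDist y i)⁻¹ * ((1 + θ) * dist (y i) (y (τ w))) :=
            mul_le_mul_of_nonneg_left h hri.le
        _ = (1 + θ) * ((nearestDist y i)⁻¹ * dist (y i) (y (τ w))) := by ring
  have hnon : ∀ u v : ↥Pat, u ≠ v → dist (u : E3) (v : E3) ≠ 1 → min ‖p u‖ ‖p v‖ < ‖p u - p v‖ := by
    intro u v huv hd
    have hnadj : ¬ (bondGraph θ y).Adj (τ u) (τ v) := fun h => hd ((hL.2.2 u v).1 h)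
    have hne : τ u ≠ τ v := fun e => huv (hτ e)
    have h := min_dist_lt_dist_of_not_adj hθ' hne hnadj (hL.1 u).symm (hL.1 v).symm
    rw [hp_norm, hp_norm, hp_sub, dist_comm (y i) (y (τ u)), dist_comm (y i) (y (τ v)), ← mul_min_of_nonneg _ _ hri.le]
    exact mul_lt_mul_of_pos_left h hri
  -- the unit directions `e`
  have hpos : ∀ u, 0 < ‖p u‖ := fun u => lt_of_lt_of_le one_pos (hrad u).1
  have hp0 : ∀ u, p u ≠ 0 := fun u => norm_ne_zero_iff.1 (hpos u).ne'
  obtain ⟨e, he⟩ : ∃ e : ↥Pat → E3, ∀ u, e u = ‖p u‖⁻¹ • p u := ⟨_, fun u => rfl⟩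
  have hunit : ∀ u, ‖e u‖ = 1 := by
    intro u; rw [he, norm_smul, norm_inv, norm_norm, inv_mul_cancel₀ (hpos u).ne']
  have hY : ∀ u, y (τ u) - y i ≠ 0 := fun u => sub_ne_zero.2 fun h => hτi u (hy h)
  have heY : ∀ u, e u = ‖y (τ u) - y i‖⁻¹ • (y (τ u) - y i) := fun u => by rw [he, hp]; exact unit_smul_of_pos hri _
  have hbrace : ∀ u v : ↥Pat, dist (u : E3) (v : E3) = Real.sqrt 2 → |⟪e u, e v⟫| ≤ β := by
    intro u v huv
    rw [heY, heY]
    exact abs_inner_unit_le (hY u) (hY v) (hB N y i τ hy hsep hL hC u v huv)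
  obtain ⟨A₀, hF0, hF1, hF2, hF3⟩ := hS e hunit
    (fun u v huv => by
      rw [he, he]
      exact inner_unit_le_of_dist_ge hθ0.le hθ1 (hrad u).1 (hrad u).2 (hrad v).1 (hrad v).2 (hall u v huv).1 (hall u v huv).2)
    (fun u v huv => by
      rw [he, he]
      exact le_inner_unit_of_dist_le (hrad u).1 (hrad v).1 (hcon u v huv).1 (hcon u v huv).2)
    (fun u v huv hd => by
      rw [he, he]
      exact inner_unit_lt_of_min_lt_dist (hrad u).1 (hrad u).2 (hrad v).1 (hrad v).2 (hnon u v huv hd))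
    hbrace
  -- frame residuals of the actual link; the gauged frame `B`
  have had : 0 ≤ aTot θ α := by simp only [aTot]; positivity
  have hd : ∀ u, ‖frameRes A₀ p u‖ ≤ aTot θ α := norm_frameRes_le A₀ he hrad h1 hF0
  have hpA : ∀ u, ‖p u - A₀ u‖ ≤ aTot θ α := by
    intro u
    have h : p u - A₀ u = A₀ (frameRes A₀ p u) := by
      simp only [frameRes, map_sub, LinearIsometryEquiv.apply_symm_apply]
    rw [h, LinearIsometryEquiv.norm_map]; exact hd u
  obtain ⟨B, hΓ, hclose⟩ := hfix p A₀ (aTot θ α) hpA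
  -- the rotation `R = B⁻¹ A₀`, the residual identity and the gauge equation
  obtain ⟨R, hR⟩ : ∃ R : E3 ≃ₗᵢ[ℝ] E3, ∀ v, R v = B.symm (A₀ v) := ⟨A₀.trans B.symm, fun v => rfl⟩
  have hM0 : ∀ v, ‖R v - v‖ ≤ κ₁ * aTot θ α * ‖v‖ := by
    intro v
    rw [hR]
    calc ‖B.symm (A₀ v) - v‖ = ‖B.symm (A₀ v) - B.symm (B v)‖ := by rw [LinearIsometryEquiv.symm_apply_apply]
      _ = ‖A₀ v - B v‖ := by rw [← map_sub, LinearIsometryEquiv.norm_map]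
      _ = ‖B v - A₀ v‖ := norm_sub_rev _ _
      _ ≤ κ * aTot θ α * ‖v‖ := hclose v
      _ ≤ κ₁ * aTot θ α * ‖v‖ := by gcongr
  have hres : ∀ u : ↥Pat, B.symm (p u) - u =
      frameRes A₀ p u + (R u - u) + (R (frameRes A₀ p u) - frameRes A₀ p u) := by
    intro u
    have e1 : B.symm (p u) = R (A₀.symm (p u)) := by rw [hR, LinearIsometryEquiv.apply_symm_apply]
    have e2 : A₀.symm (p u) = (u : E3) + frameRes A₀ p u := by simp only [frameRes]; abel
    rw [e1, e2, map_add]; abel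
  have hg : ∑ u : ↥Pat, cross (u : E3) (frameRes A₀ p u + (R u - u) + (R (frameRes A₀ p u) - frameRes A₀ p u)) = 0 := by
    refine Eq.trans (Finset.sum_congr rfl fun u _ => ?_) ((lsGauge_iff_sum_cross _).1 hΓ)
    simp only [hres u]
  -- bootstrap of the operator bound
  have hLd : ‖lsRot Pat (frameRes A₀ p)‖ ≤ Ω + 3 / 2 * (θ * α) := by
    have h := norm_lsRot_frameRes_sub_le hcard A₀ he hrad h1 hF0
    calc ‖lsRot Pat (frameRes A₀ p)‖
        = ‖(lsRot Pat (frameRes A₀ p) - lsRot Pat (frameRes A₀ e)) + lsRot Pat (frameRes A₀ e)‖ := by rw [sub_add_cancel]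
      _ ≤ ‖lsRot Pat (frameRes A₀ p) - lsRot Pat (frameRes A₀ e)‖ + ‖lsRot Pat (frameRes A₀ e)‖ := norm_add_le _ _
      _ ≤ _ := by linarith [hF1]
  obtain ⟨hT0, hMT'⟩ := dev_bound_iterate hframe hcard h1 hg hd hLd hM0 (mul_nonneg hκ1 had) had k
  have hMT : ∀ v, ‖R v - v‖ ≤ T * ‖v‖ := fun v => (hMT' v).trans (mul_le_mul_of_nonneg_right hT (norm_nonneg v))
  have hTn : 0 ≤ T := hT0.trans hT
  -- reading the clauses
  have e0 : ∀ u : ↥Pat, resAt y i B (τ u) u = B.symm (p u) - u := fun u => by simp only [resAt, hp]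
  have hdir : ∀ n ∈ D, ∀ v : E3, ∀ b : ℝ, ‖v‖ ≤ b → ⟪n, v⟫ ≤ b := by
    intro n hn v b hv
    calc ⟪n, v⟫ ≤ ‖n‖ * ‖v‖ := real_inner_le_norm _ _
      _ ≤ 1 * ‖v‖ := mul_le_mul_of_nonneg_right (hD n hn) (norm_nonneg _)
      _ ≤ b := by rw [one_mul]; exact hv
  have hshell : ∀ n ∈ D, ∀ u : ↥Pat, ⟪n, resAt y i B (τ u) u⟫ ≤ V₁ + slop₁ θ α T := by
    intro n hn u
    rw [e0 u, hres u]
    have s1 := inner_res_le hframe hcard h1 hg hMT hd hTn (hD n hn) u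
    have s2 := inner_derot_frameRes_le hcard A₀ he hrad h1 hF0 (hD n hn) u
    have s3 := hF2 n hn u
    simp only [slop₁, derot] at s1 s2 s3 ⊢
    linarith
  have hxK : ∀ u : ↥Pat, ‖resAt y i B (τ u) u‖ ≤ K * θ := fun u =>
    (norm_le_of_covers hρ hcov fun n hn => hshell n hn u).trans hK
  have hBu : ∀ u : ↥Pat, ‖(y (τ u) - y i) - nearestDist y i • B.toLinearIsometry (u : E3)‖ ≤ K * θ * nearestDist y i := by
    intro u
    rw [LinearIsometryEquiv.coe_toLinearIsometry, norm_sub_smul_eq y i B hr (τ u) u]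
    calc nearestDist y i * ‖resAt y i B (τ u) u‖ ≤ nearestDist y i * (K * θ) := mul_le_mul_of_nonneg_left (hxK u) hr.le
      _ = K * θ * nearestDist y i := by ring
  have hcap := hQ N y i τ hy hsep hL hC B.toLinearIsometry hBu
  have hc : ∀ u v : ↥Pat, dist (u : E3) (v : E3) = Real.sqrt 2 → ∀ m, IsCap θ y i τ u v m →
      ‖resAt y i B m ((u : E3) + v)‖ ≤ Kq * θ := by
    intro u v huv m hm
    have h := hcap u v m huv hm.1 hm.2
    rw [LinearIsometryEquiv.coe_toLinearIsometry, norm_sub_smul_eq y i B hr m] at h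
    exact le_of_mul_le_mul_left (by linarith [h]) hr
  have hgauge : lsGauge Pat (fun u => resAt y i B (τ u) u) := by
    have h : (fun u => resAt y i B (τ u) u) = fun u => B.symm (p u) - u := funext e0
    rw [h]; exact hΓ
  refine ⟨B, hshell, ?_, ?_, ?_, hgauge⟩
  · intro n hn u v huv m hm; exact hdir n hn _ _ (hc u v huv m hm)
  · intro n hn u w huw
    rw [e0 u, e0 w, hres u, hres w]
    have huw' : ‖(u : E3) - w‖ = 1 := by rw [← dist_eq_norm]; exact huw
    have s1 := inner_res_sub_le hframe hcard h1 hg hMT hd hTn (hD n hn) huw'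
    have s2 := inner_derot_frameRes_sub_le hcard A₀ he hrad h1 hF0 (hD n hn) huw'
    have s3 := hF3 n hn u w huw
    simp only [slop₃, derot] at s1 s2 s3 ⊢
    linarith
  · intro n hn u v huv m hm w _
    refine hdir n hn _ _ ((norm_sub_le _ _).trans ?_)
    linarith [hc u v huv m hm, hxK w]

/-! ### The two kissing patterns at the registered `θ = 1/100`, `D = probes26` (`ρ = 11281/10000`), `κ₁ = 3465/1000 ≥ 2√3` -/

/-- ★★★ **`LsEntryAt fcc P` from `CapBrace β (1/100) fcc`, a braced `Rig` run in `SphericalLsFit` format, and decidable arithmetic**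
(`K` = the shell constant fed to the tree's cap a-priori `capAprioriAt_trilateration_fcc`). -/
theorem lsEntryAt_fcc_of_sphericalLsFit {β α Ω V₁ V₃ K T : ℝ} {k : ℕ}
    (hB : CapBrace β (1 / 100) fccKissingPattern)
    (hS : SphericalLsFit β (1 / 100) fccKissingPattern probes26 α Ω V₁ V₃) (hα : 0 ≤ α)
    (hK0 : 0 ≤ K) (hKθ : (K + 2 + 1 / 100) * (1 / 100) ≤ 1 / 5)
    (hT : (ledgerStep (Ω + 3 / 2 * (1 / 100 * α)) (aTot (1 / 100) α))^[k] (3465 / 1000 * aTot (1 / 100) α) ≤ T)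
    (hK : 11281 / 10000 * (V₁ + slop₁ (1 / 100) α T) ≤ K * (1 / 100)) :
    LsEntryAt fccKissingPattern
      (V₁ + slop₁ (1 / 100) α T, (2 * (K + 2 + 1 / 100) + (K + 2 + 1 / 100) ^ 2 * (1 / 100)) * (1 / 100),
        V₃ + slop₃ (1 / 100) α T, (2 * (K + 2 + 1 / 100) + (K + 2 + 1 / 100) ^ 2 * (1 / 100) + K) * (1 / 100)) :=
  gEntryAt_lsGauge_of_sphericalLsFit (by norm_num) (by norm_num) fcc_contactSeparating card_fccKissingPattern
    (fun _ hz => norm_eq_one_of_mem_fccKissingPattern hz) frame_fcc norm_le_one_of_mem_probes26 (by norm_num) coversProbes26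
    gaugeFix_fcc two_sqrt_three_le (by norm_num) (capAprioriAt_trilateration_fcc (by norm_num) (by norm_num) hK0 hKθ) hB hS hα hT hK

/-- ★★★ the same at **hcp**. -/
theorem lsEntryAt_hcp_of_sphericalLsFit {β α Ω V₁ V₃ K T : ℝ} {k : ℕ}
    (hB : CapBrace β (1 / 100) hcpKissingPattern)
    (hS : SphericalLsFit β (1 / 100) hcpKissingPattern probes26 α Ω V₁ V₃) (hα : 0 ≤ α)
    (hK0 : 0 ≤ K) (hKθ : (K + 2 + 1 / 100) * (1 / 100) ≤ 1 / 5)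
    (hT : (ledgerStep (Ω + 3 / 2 * (1 / 100 * α)) (aTot (1 / 100) α))^[k] (3465 / 1000 * aTot (1 / 100) α) ≤ T)
    (hK : 11281 / 10000 * (V₁ + slop₁ (1 / 100) α T) ≤ K * (1 / 100)) :
    LsEntryAt hcpKissingPattern
      (V₁ + slop₁ (1 / 100) α T, (2 * (K + 2 + 1 / 100) + (K + 2 + 1 / 100) ^ 2 * (1 / 100)) * (1 / 100),
        V₃ + slop₃ (1 / 100) α T, (2 * (K + 2 + 1 / 100) + (K + 2 + 1 / 100) ^ 2 * (1 / 100) + K) * (1 / 100)) :=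
  gEntryAt_lsGauge_of_sphericalLsFit (by norm_num) (by norm_num) hcp_contactSeparating card_hcpKissingPattern
    (fun _ hz => norm_eq_one_of_mem_hcpKissingPattern hz) frame_hcp norm_le_one_of_mem_probes26 (by norm_num) coversProbes26
    gaugeFix_hcp two_sqrt_three_le (by norm_num) (capAprioriAt_trilateration_hcp (by norm_num) (by norm_num) hK0 hKθ) hB hS hα hT hK

/-- **Worked instance of the arithmetic side conditions** (illustrative constants `α = 11/100`, `Ω = 3/40`: `κ₁·a = 0.4196…`, chain
`0.42 → 0.25 → 0.16 → 0.12 → 0.106 → 0.102 → 0.101`, so `T = 101/1000` after six bootstrap steps; then `slop₁ = 0.04843 ≤ 485/10000`). -/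
example : (ledgerStep (3 / 40 + 3 / 2 * (1 / 100 * (11 / 100))) (aTot (1 / 100) (11 / 100)))^[6]
    (3465 / 1000 * aTot (1 / 100) (11 / 100)) ≤ 101 / 1000 := by
  refine iterate_ledgerStep_le_of_chain (by norm_num) (by norm_num [aTot]) (by norm_num [aTot])
    (fun j => if j = 0 then 42 / 100 else if j = 1 then 25 / 100 else if j = 2 then 16 / 100 else if j = 3 then 12 / 100
      else if j = 4 then 106 / 1000 else if j = 5 then 102 / 1000 else 101 / 1000) 6 (by norm_num [aTot]) ?_
  intro j hj
  interval_cases j <;> norm_num [ledgerStep, aTot]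

example : slop₁ (1 / 100) (11 / 100) (101 / 1000) ≤ 485 / 10000 := by norm_num [slop₁, aTot]

example : slop₃ (1 / 100) (11 / 100) (101 / 1000) ≤ 718 / 10000 := by norm_num [slop₃, aTot]

end Arrow

end Summit.AtomisticToContinuum.Crystallization.Theorems.FrustratedLawDichotomyTwoShellRigidityLsLedger
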